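import Literature.Computability.MetaComplexity.EFModMulUSys
import HarnessLib

/-!
# The zero law of uniform modular multiplication: false masks give a zero product

Layer E/5 (uniform variant). `ModMulU.Zero.isBlock_lines`: for an available multiplier `V`
(`ModMulU.mulT`, with its comparator `CA = (a, n)` available and answering `<`) all of whose
mask bits are false (facts), every partial product `P_t` is bitwise false, stage by stage —
`P_0 = z` is the zero gate, and `P_{t+1} = R(D_t) ⊕ mk_t` with `D_t = P_t ⊕ P_t` is twice a
modular sum of false words (`ModMulU.LD.ZeroData`). Both `0 ⊗ b = 0` (masks `b_j ∧ 0`) and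
`a ⊗ 0 = 0` (masks `0 ∧ a_i`) are instances (`mask` facts by `rAndF2` / `rAndF`).

## Sources

* S. A. Cook, R. A. Reckhow, *The relative efficiency of propositional proof systems*,
  J. Symbolic Logic 44 (1979), §2.
-/

namespace Literature.Computability.MetaComplexity

open _root_.Computability Complexity Complexity.PropForm Netlist Cluster FregeSystem

namespace ModMulU

/-- The false output bits of the zero block. [folklore] -/
theorem LD.ZeroData.mem_segs_notR (d : LD.ZeroData) {K : PropForm ℕ} {i : ℕ} (hi : i < d.L) :
    ctx K (neg (var (d.MM.R d.L i))) ∈ (d.segs K).flatten := by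
  simp only [LD.ZeroData.segs, List.flatten_cons, List.flatten_nil, List.mem_append, List.append_nil]
  exact Or.inr (Or.inr (Or.inr (Or.inl (List.mem_map.2 ⟨i, List.mem_range.2 hi, rfl⟩))))

namespace Zero

variable (V : View) (L : ℕ) (K : PropForm ℕ)

/-- The zero data of the doubling `D_t = P_t ⊕ P_t`. [folklore] -/
def zd1 (t : ℕ) : LD.ZeroData where
  L := L
  bMM := V.base + offD L t
  za := V.P L t
  zb := V.P L t
  nw := V.n
  bCA := V.rbase L 1
  xa := V.a
  w := V.P L t

/-- The zero data of the accumulation `A_t = R(D_t) ⊕ mk_t`. [folklore] -/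
def zd2 (t : ℕ) : LD.ZeroData where
  L := L
  bMM := V.base + offA L t
  za := (V.Dv L t).R L
  zb := V.msk L t
  nw := V.n
  bCA := V.rbase L 1
  xa := V.a
  w := V.P L t

/-- The lines of the stages below `t`. [folklore] -/
def upTo : ℕ → List (PropForm ℕ)
  | 0 => [ctx K (neg (var V.z))]
  | t + 1 => upTo t ++ (((zd1 V L t).segs K).flatten ++ ((zd2 V L t).segs K).flatten)

/-- **The lines of the zero law.** [folklore] -/
def lines : List (PropForm ℕ) := upTo V L K L

variable {V L K} {G : FregeSystem} {Γ : Set (PropForm ℕ)}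

/-- `¬P_t i` is among the lines up to `t`. [folklore] -/
theorem mem_upTo : ∀ {t i : ℕ}, i < L → ctx K (neg (var (V.P L t i))) ∈ upTo V L K t
  | 0, _, _ => List.mem_singleton_self _
  | t + 1, i, hi => by
    rw [View.P_succ]
    exact List.mem_append_right _ (List.mem_append_right _ ((zd2 V L t).mem_segs_notR (K := K) hi))

/-- `upTo` is monotone. [folklore] -/
theorem upTo_mono {s t : ℕ} (hst : s ≤ t) : ∀ χ ∈ upTo V L K s, χ ∈ upTo V L K t := by
  induction hst with
  | refl => exact fun χ h => h
  | step _ ih => exact fun χ h => List.mem_append_left _ (ih χ h)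

/-- **The zero law of modular multiplication inside Frege**: with all masks false, every partial
product is bitwise false. [cite: CookReckhow1979, §2] -/
theorem isBlock_upTo (hGK : ∀ r ∈ LD.maskRules, r ∈ G.rules) (hGL : ∀ r ∈ Logic.rules, r ∈ G.rules) (hV : V.Avail L K Γ)
    (hCA : (V.CA L).Avail K Γ L) (hlt : ctx K (neg (var ((V.CA L).ge L L))) ∈ Γ) {k : ℕ} (hk : k ≤ L)
    (hm : ∀ t < k, ∀ i < L, ctx K (neg (var (V.msk L t i))) ∈ Γ) : ∀ t ≤ k, G.IsBlock Γ (upTo V L K t) := by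
  intro t ht
  induction t with
  | zero =>
    exact FregeSystem.IsBlock.singleton (Or.inr (Logic.infer hGL 11 (by decide) (FregeSystem.sub [K, var V.z]) rfl
      (FregeSystem.prems_cons hV.hz FregeSystem.prems_nil)))
  | succ t ih =>
    have ht' : t < L := by omega
    have htk : t < k := by omega
    have hΓ : Γ ⊆ Γ ∪ {χ | χ ∈ upTo V L K t} := Set.subset_union_left
    refine (ih (by omega)).append (((zd1 V L t).isBlock_segs hGK hGL ((hV.hD t ht').mono hΓ) (hCA.mono hΓ)
      (fun i hi => Or.inr (mem_upTo hi)) (fun i hi => Or.inr (mem_upTo hi)) (fun i hi => Or.inr (mem_upTo hi))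
      (hΓ hlt)).append ((zd2 V L t).isBlock_segs hGK hGL (((hV.hA t ht').mono hΓ).mono Set.subset_union_left)
      ((hCA.mono hΓ).mono Set.subset_union_left) (fun i hi => Or.inr ((zd1 V L t).mem_segs_notR hi))
      (fun i hi => Or.inl (hΓ (hm t htk i hi))) (fun i hi => Or.inl (Or.inr (mem_upTo hi))) (Or.inl (hΓ hlt))))

/-- **The zero law**: the lines form a block. [cite: CookReckhow1979, §2] -/
theorem isBlock_lines (hGK : ∀ r ∈ LD.maskRules, r ∈ G.rules) (hGL : ∀ r ∈ Logic.rules, r ∈ G.rules) (hV : V.Avail L K Γ)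
    (hCA : (V.CA L).Avail K Γ L) (hlt : ctx K (neg (var ((V.CA L).ge L L))) ∈ Γ)
    (hm : ∀ t < L, ∀ i < L, ctx K (neg (var (V.msk L t i))) ∈ Γ) : G.IsBlock Γ (lines V L K) :=
  isBlock_upTo hGK hGL hV hCA hlt le_rfl hm L le_rfl

/-- **Conclusion of the zero law**: `¬P_t i` for all `t ≤ L`, in particular the output is false. [folklore] -/
theorem mem_lines {t i : ℕ} (ht : t ≤ L) (hi : i < L) : ctx K (neg (var (V.P L t i))) ∈ lines V L K :=
  upTo_mono ht _ (mem_upTo hi)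

/-- Size of the stages below `t`. [folklore] -/
theorem proofSize_upTo : ∀ t, proofSize (upTo V L K t) ≤ (1 + t * (8 * L + 4)) * (K.size + 12) := by
  intro t
  induction t with
  | zero =>
    refine (ModAddU.Bounded.proofSize_le (B := K.size + 12) (ModAddU.Bounded.singleton ?_)).trans (by simp)
    rw [ModAddU.size_ctx]; simp [size]
  | succ t ih =>
    rw [upTo, proofSize_append, proofSize_append]
    have h1 := ((zd1 V L t).bounded_segs K).proofSize_le
    have h2 := ((zd2 V L t).bounded_segs K).proofSize_le
    rw [(zd1 V L t).length_segs K] at h1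
    rw [(zd2 V L t).length_segs K] at h2
    have e1 : (zd1 V L t).L = L := rfl
    have e2 : (zd2 V L t).L = L := rfl
    rw [e1] at h1; rw [e2] at h2
    nlinarith

/-- **Size of the zero law**: `≤ (1 + L(8L + 4))(|K| + 12)`. [folklore] -/
theorem proofSize_lines : proofSize (lines V L K) ≤ (1 + L * (8 * L + 4)) * (K.size + 12) := proofSize_upTo L

/-! ### The two instances: masks with a false operand -/

/-- **Masks of `a ⊗ 0`**: a false multiplier bit gives false masks. [cite: CookReckhow1979, §2] -/
theorem isBlock_maskF_of_bit (hGL : ∀ r ∈ Logic.rules, r ∈ G.rules) (hV : V.Avail L K Γ) {t : ℕ} (ht : t < L)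
    (hb : ctx K (neg (var (V.b (L - 1 - t)))) ∈ Γ) :
    G.IsBlock Γ ((List.range L).map fun i => ctx K (neg (var (V.msk L t i)))) :=
  Scaffold.isBlock_of_forall fun θ hθ => by
    obtain ⟨i, hi, rfl⟩ := List.mem_map.1 hθ
    rw [List.mem_range] at hi
    exact Or.inr (Logic.infer hGL 16 (by decide) (FregeSystem.sub [K, var (V.msk L t i), var (V.b (L - 1 - t)), var (V.a i)]) rfl
      (FregeSystem.prems_cons (hV.hmk t ht i hi) (FregeSystem.prems_cons hb FregeSystem.prems_nil)))

/-- **Masks of `0 ⊗ b`**: a false multiplicand gives false masks. [cite: CookReckhow1979, §2] -/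
theorem isBlock_maskF_of_word (hGS : ∀ r ∈ Sys.glue, r ∈ G.rules) (hV : V.Avail L K Γ) {t : ℕ} (ht : t < L)
    (ha : ∀ i < L, ctx K (neg (var (V.a i))) ∈ Γ) :
    G.IsBlock Γ ((List.range L).map fun i => ctx K (neg (var (V.msk L t i)))) :=
  Scaffold.isBlock_of_forall fun θ hθ => by
    obtain ⟨i, hi, rfl⟩ := List.mem_map.1 hθ
    rw [List.mem_range] at hi
    refine Or.inr (Sys.glue_infer hGS 2 (by decide) (FregeSystem.sub [K, var (V.msk L t i), var (V.b (L - 1 - t)), var (V.a i)])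
      rfl fun ψ hψ => ?_)
    simp only [Sys.glue, List.getElem_cons_succ, List.getElem_cons_zero, Sys.rAndF2, List.mem_cons, List.not_mem_nil,
      or_false] at hψ
    rcases hψ with rfl | rfl
    exacts [hV.hmk t ht i hi, ha i hi]

/-- **All masks of `a ⊗ 0`** (every stage): false multiplier bits give false masks. [cite: CookReckhow1979, §2] -/
theorem isBlock_maskF_of_bit_all (hGL : ∀ r ∈ Logic.rules, r ∈ G.rules) (hV : V.Avail L K Γ)
    (hb : ∀ t < L, ctx K (neg (var (V.b (L - 1 - t)))) ∈ Γ) :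
    G.IsBlock Γ (((List.range L).map fun t => (List.range L).map fun i => ctx K (neg (var (V.msk L t i)))).flatten) := by
  refine Scaffold.isBlock_of_forall fun θ hθ => ?_
  obtain ⟨l, hl, hθ⟩ := List.mem_flatten.1 hθ
  obtain ⟨t, ht, rfl⟩ := List.mem_map.1 hl
  rw [List.mem_range] at ht
  obtain ⟨i, hi, rfl⟩ := List.mem_map.1 hθ
  rw [List.mem_range] at hi
  exact Or.inr (Logic.infer hGL 16 (by decide) (FregeSystem.sub [K, var (V.msk L t i), var (V.b (L - 1 - t)), var (V.a i)]) rfl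
    (FregeSystem.prems_cons (hV.hmk t ht i hi) (FregeSystem.prems_cons (hb t ht) FregeSystem.prems_nil)))

/-- **All masks of `0 ⊗ b`** (every stage): a false multiplicand gives false masks. [cite: CookReckhow1979, §2] -/
theorem isBlock_maskF_of_word_all (hGS : ∀ r ∈ Sys.glue, r ∈ G.rules) (hV : V.Avail L K Γ)
    (ha : ∀ i < L, ctx K (neg (var (V.a i))) ∈ Γ) : G.IsBlock Γ (((List.range L).map fun t => (List.range L).map fun i => ctx K (neg (var (V.msk L t i)))).flatten) := by
  refine Scaffold.isBlock_of_forall fun θ hθ => ?_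
  obtain ⟨l, hl, hθ⟩ := List.mem_flatten.1 hθ
  obtain ⟨t, ht, rfl⟩ := List.mem_map.1 hl
  rw [List.mem_range] at ht
  obtain ⟨i, hi, rfl⟩ := List.mem_map.1 hθ
  rw [List.mem_range] at hi
  refine Or.inr (Sys.glue_infer hGS 2 (by decide) (FregeSystem.sub [K, var (V.msk L t i), var (V.b (L - 1 - t)), var (V.a i)])
    rfl fun ψ hψ => ?_)
  simp only [Sys.glue, List.getElem_cons_succ, List.getElem_cons_zero, Sys.rAndF2, List.mem_cons, List.not_mem_nil,
    or_false] at hψ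
  rcases hψ with rfl | rfl
  exacts [hV.hmk t ht i hi, ha i hi]

end Zero

end ModMulU

end Literature.Computability.MetaComplexity
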